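import Summits.Ventures.PercRepro.ProfileTwoAverage
import Summits.Ventures.PercRepro.HallDisjointDegreeHall

/-!
# PercRepro — HALL FOR DISJOINTNESS ON THE INDEPENDENT PAIRS OF A RANK-2 MATROID OF COGIRTH `≥ 3`
(p10, gen 5; `proofs/P10-HALLROW.md` §8 — the statement `RankTwoHall` of `NullityTwoDual`, proved)

Let `N` be a finite matroid of rank `2` and cogirth `≥ 3` (`CogirthGe' N 3`: a subset of the ground set missing
fewer than three elements spans).  The independent pairs `𝒞 = indepSets N 2` form a family of 2-sets in which
every point has degree `≥ 3`: for `x` in an independent pair, the flat `cl{x}` has rank `1 < 2`, so by the cogirth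
condition `E ∖ cl{x}` has at least three elements `y`, and each `{x, y}` is an independent pair
(`ρ{x, y} = ρ{x} + 1 = 2` since `y ∉ cl{x}`).  Hence Hall's condition for disjointness holds on `𝒞` for every
sub-family, by the degree-only Hall lemma `hall_disjoint_of_degree` — with no exceptional configuration and
without the hypothesis `7 ≤ #E`.

* `rk_clF_singleton` — `ρ(cl{x}) = ρ{x}`;
* `three_le_card_sdiff_clF` — `E ∖ cl{x}` has `≥ 3` elements for a non-loop `x` (rank `2`, cogirth `≥ 3`);
* `pair_mem_indepSets_of_notMem_clF` — `{x, y}` is an independent pair when `ρ{x} = 1` and `y ∈ E ∖ cl{x}`;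
* `three_le_deg_indepSets` — the degree condition;
* **`hall_indepSets_two_of_cogirth`** — Hall's condition for disjointness on `indepSets N 2`.
-/

open scoped Matroid

namespace PercRepro.Cogirth

open Finset ThmH Skew Shadow Profile HallDisjoint

variable {α : Type} [DecidableEq α] {N : Matroid α} [N.Finite]

omit [DecidableEq α] in
/-- `ρ(cl{x}) = ρ{x}`. -/
theorem rk_clF_singleton (x : α) : rk N (clF N {x}) = rk N {x} := by
  unfold rk
  congr 1
  rw [coe_clF]
  exact N.eRk_closure_eq _

/-- In a rank-2 matroid of cogirth `≥ 3`, the ground set minus `cl{x}` has at least three elements for every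
`x` of rank `1`. -/
theorem three_le_card_sdiff_clF (hR : rk N (gr N) = 2) (hc : CogirthGe' N 3) {x : α} (hx : rk N {x} = 1) :
    3 ≤ (gr N \ clF N {x}).card := by
  by_contra hlt
  have hsub : clF N {x} ⊆ gr N := by
    intro y hy
    have h1 : y ∈ N.closure (({x} : Finset α) : Set α) := by rw [← coe_clF]; exact_mod_cast hy
    have h2 : y ∈ N.E := N.closure_subset_ground _ h1
    rw [← coe_gr] at h2
    exact_mod_cast h2
  have h := hc (clF N {x}) hsub (by omega)
  rw [rk_clF_singleton, hx, hR] at h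
  omega

/-- For `x` of rank `1` and `y ∈ E ∖ cl{x}`, the pair `{x, y}` is an independent pair. -/
theorem pair_mem_indepSets_of_notMem_clF {x y : α} (hx : x ∈ gr N) (hx1 : rk N {x} = 1) (hy : y ∈ gr N)
    (hyc : y ∉ clF N {x}) : ({x, y} : Finset α) ∈ indepSets N 2 := by
  have hxx : x ∈ clF N {x} := by
    have h1 : x ∈ N.closure (({x} : Finset α) : Set α) := by
      apply N.subset_closure (({x} : Finset α) : Set α) (by
        rw [← coe_gr]; exact_mod_cast (singleton_subset_iff.2 hx))
      rw [Finset.coe_singleton]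
      exact Set.mem_singleton x
    rw [← coe_clF] at h1
    exact_mod_cast h1
  have hxy : x ≠ y := fun h => hyc (h ▸ hxx)
  have hrk : rk N (insert y {x}) = 2 := by
    rw [rk_insert_eq hy (singleton_subset_iff.2 hx), if_neg hyc, hx1]
  have hpair : ({x, y} : Finset α) = insert y {x} := pair_comm x y
  rw [mem_indepSets]
  refine ⟨?_, card_pair hxy, ?_⟩
  · intro z hz
    rw [mem_insert, mem_singleton] at hz
    rcases hz with rfl | rfl
    · exact hx
    · exact hy
  · apply indep_of_rk_eq_card
    rw [hpair, hrk, ← hpair, card_pair hxy]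

/-- **The degree condition**: every point of an independent pair of a rank-2 matroid of cogirth `≥ 3` lies in
at least three independent pairs. -/
theorem three_le_deg_indepSets (hR : rk N (gr N) = 2) (hc : CogirthGe' N 3) {C : Finset α}
    (hC : C ∈ indepSets N 2) {x : α} (hxC : x ∈ C) : 3 ≤ deg (indepSets N 2) x := by
  rw [mem_indepSets] at hC
  obtain ⟨hCg, hC2, hCi⟩ := hC
  have hx : x ∈ gr N := hCg hxC
  have hx1 : rk N {x} = 1 := by
    rw [rk_eq_card_of_indep (hCi.subset (by exact_mod_cast (singleton_subset_iff.2 hxC)))]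
    exact card_singleton x
  have h3 := three_le_card_sdiff_clF hR hc hx1
  have hinj : (gr N \ clF N {x}).card ≤ ((indepSets N 2).filter (fun D => x ∈ D)).card := by
    apply card_le_card_of_injOn (fun y => ({x, y} : Finset α))
    · intro y hy
      rw [Finset.mem_coe, mem_sdiff] at hy
      rw [Finset.mem_coe, mem_filter]
      exact ⟨pair_mem_indepSets_of_notMem_clF hx hx1 hy.1 hy.2, mem_insert_self x {y}⟩
    · intro y hy y' hy' h
      rw [Finset.mem_coe, mem_sdiff] at hy hy'
      have hxx : x ∈ clF N {x} := by
        have h1 : x ∈ N.closure (({x} : Finset α) : Set α) := by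
          apply N.subset_closure (({x} : Finset α) : Set α) (by
            rw [← coe_gr]; exact_mod_cast (singleton_subset_iff.2 hx))
          rw [Finset.coe_singleton]
          exact Set.mem_singleton x
        rw [← coe_clF] at h1
        exact_mod_cast h1
      have hy'x : y' ≠ x := fun h' => hy'.2 (h' ▸ hxx)
      have : y ∈ ({x, y'} : Finset α) := by
        simp only at h
        rw [← h]
        exact mem_insert_of_mem (mem_singleton_self y)
      rw [mem_insert, mem_singleton] at this
      rcases this with h' | h'
      · exact absurd (h' ▸ hxx) hy.2
      · exact h'
  unfold deg
  omega

/-- **Hall's condition for disjointness on the independent pairs of a rank-2 matroid of cogirth `≥ 3`** —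
the statement `RankTwoHall` of `NullityTwoDual`, for every family and without the size hypothesis `7 ≤ #E`. -/
theorem hall_indepSets_two_of_cogirth (hR : rk N (gr N) = 2) (hc : CogirthGe' N 3) {𝒜 : Finset (Finset α)}
    (h𝒜 : 𝒜 ⊆ indepSets N 2) : 𝒜.card ≤ (nbr (indepSets N 2) 𝒜).card :=
  hall_disjoint_of_degree (fun _ hC => (mem_indepSets.1 hC).2.1)
    (fun _ hC _ hxC => three_le_deg_indepSets hR hc hC hxC) h𝒜

end PercRepro.Cogirth
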